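import Literature.NumberTheory.EllipticCurves.BSDRootNumber
import Literature.NumberTheory.EllipticCurves.RootNumberAtkinLehnerProofs
import Literature.NumberTheory.EllipticCurves.RootNumberAtkinLehnerSemistableProofs
import Literature.NumberTheory.EllipticCurves.RootNumberLocalSmulProofs
import Literature.NumberTheory.EllipticCurves.RootNumberLocalSqEqOneProofs
import Literature.NumberTheory.EllipticCurves.AtkinLehnerInvolutionsNewformProofs
import Literature.NumberTheory.DiophantineGeometry.LocalReductionProofs
import Literature.NumberTheory.DiophantineGeometry.ConductorAdditiveProofs
import Literature.RingTheory.DiscreteValuationRing.AdicCompletionResidueField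
import HarnessLib

/-!
# BSD family — local root-number tables at `2` and `3` (proofs): the trust base of
# `exists_local_tables_two_three`

A `…Proofs` sibling (theorems only: no definition, no named fact, no instance) of
`Literature.NumberTheory.EllipticCurves.BSDRootNumber`, written by the `provefact` seat of the named
fact `Literature.NumberTheory.EllipticCurves.exists_local_tables_two_three` (**bsd.S36**,
Halberstadt's local tables in existential form): there are tables
`w_v : WeierstrassCurve ℚ_v → {±1}`, one for each finite place `v` of `ℚ`, invariant under every
change of variables over `ℚ_v`, equal to Rohrlich's `localRootNumber` on elliptic curves above
`p ≥ 5`, and computing the *analytic* global root number of every elliptic `E/ℚ`: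
`w(E) = −∏_v w_v(E ×_ℚ ℚ_v)` (Kellock–Dokchitser 2023, Def. 2.1 and Thm. 2.3; Halberstadt 1998;
Deligne 1973).

## What is proved, and what the discharge still needs

The analytic root number `WeierstrassCurve.rootNumber` is the sign of the functional equation of
the entire continuation of `N_E^{s/2}(2π)^{-s}Γ(s)L(E,s)`; no statement relating it to local data
can be proved without the Modularity Theorem, which the tree carries as the (undischarged) named
fact `Literature.NumberTheory.EllipticCurves.ModularForms.exists_isNewformOf` (BCDT 2001, Thm. A).
Exactly as the siblings `RootNumberProductFormulaProofs`, `RootNumberAtkinLehnerProofs` do for the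
guarded product formula `WeierstrassCurve.rootNumber_eq_algebraicRootNumber` (no additive reduction
above `2, 3`), this file reduces the unguarded, existential statement to its printed inputs:

* `exists_local_tables_two_three_of_atkinLehner` — `exists_local_tables_two_three` follows from
  1. the Modularity Theorem `exists_isNewformOf` (BCDT 2001, Thm. A; Diamond–Shurman Thm. 8.8.3);
  2. Kellock–Dokchitser 2023, Remark 2.2 at the primes `p ≥ 5` dividing `N_E`, i.e. the tree's
     named fact `WeierstrassCurve.atkinLehnerEigenvalueAt_eq_localRootNumberAt` ("the local root
     number at a prime `p` agrees with the eigenvalue of the associated Atkin–Lehner involution for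
     the associated modular form", PDF p. 7 of the held copy `paper:arxiv-2303.07883`), taken for
     every `W`;
  3. the same Remark 2.2 together with Def. 2.1 (`w(E/K_v) ∈ {±1}`), Thm. 2.3(ii) (`w = +1` at good
     reduction) and "the root number `w(E/F_v)` only depends on the isomorphism class of `E/F_v`"
     (proof of Lemma 2.6, PDF p. 8) **at the two places above `2` and `3`**, in table form: for each
     finite place `v` of `ℚ` of residue characteristic `≤ 3` there is a `±1`-valued function of
     Weierstrass curves over `ℚ_v`, invariant under changes of variables over `ℚ_v`, whose value on
     `E ×_ℚ ℚ_v` is the Atkin–Lehner eigenvalue `λ(Q_p)(f_E)` if `p ∣ N_E` and `1` if `p ∤ N_E`.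
     This is the part of Halberstadt's theorem (CRAS 326 (1998): tables for `w(E/ℚ₂)`, `w(E/ℚ₃)`)
     that the tree does not have in any form — Rohrlich's `localRootNumber` is the documented junk
     value `0` at additive places above `2, 3` — and it is taken here as an explicit hypothesis,
     not vendored as a new named fact (D-0026);
  together with theorems of the tree: Hecke's functional equation for weight-`2` newforms and
  `ε(f) = ±1` (`IsNewform0.exists_functional_equation_holds`,
  `IsNewform0.frickeEigenvalue_eq_one_or_eq_neg_one_holds`), Atkin–Lehner's
  `ε(f) = ∏_{p ∣ N} λ(Q_p)` (`IsNewform0.frickeEigenvalue_eq_prod_atkinLehnerEigenvalueAt_holds`,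
  Knapp 1993, Thm. 9.27(c)), `w(E) = −ε(f_E)` (`hasFunctionalEquationSign_of_isNewformOf`,
  `hasFunctionalEquationSign_unique_holds`), Rohrlich's `localRootNumber` is `±1` and an isomorphism
  invariant above `p ≥ 5` (`localRootNumber_sq_eq_one_holds`, `localRootNumber_smul_holds`), and
  bad places divide the conductor
  (`natGenerator_mem_primeFactors_conductorNorm_of_localRootNumberAt_ne_one`).

The tables are: above `p ≥ 5`, Rohrlich's `localRootNumber` over `O_v` on elliptic curves and `1`
on singular ones; above `2, 3`, the hypothesised tables. So the trust base of
`exists_local_tables_two_three` in the tree is {Modularity, Kellock–Dokchitser Rem. 2.2 at every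
prime (at `p ≥ 5` against Rohrlich's list, at `p = 2, 3` in table form)}; the discharge
`exists_local_tables_two_three_holds` is blocked upstream on `exists_isNewformOf`.

* `rootNumber_eq_neg_finprod_of_exists_isNewformOf` — the reusable core: under modularity, if an
  integer-valued `g` on the finite places satisfies `g(v) = λ(Q_p)(f_E)` for `p ∣ N_E` and
  `g(v) = 1` for `p ∤ N_E`, then `w(E) = −∏ᶠ_v g(v)`.

* `exists_local_tables_two_three_of_residual` (second pass, same seat) — sharpens the reduction:
  hypothesis 3 (`hloc`, existence of the tables above `2, 3`) is replaced by its genuinely residual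
  part, the locality of the Atkin–Lehner sign at the *additive* places above `2, 3`: for elliptic
  `W₁, W₂ / ℚ` with newforms `f₁, f₂`, `W₁` additive at `v ∣ 6` and `W₁ ×_ℚ ℚ_v ≅ W₂ ×_ℚ ℚ_v` over
  `ℚ_v`, `λ(Q_p)(f₁) = λ(Q_p)(f₂)` (Kellock–Dokchitser Rem. 2.2 with "`w(E/F_v)` only depends on the
  isomorphism class of `E/F_v`", proof of Lemma 2.6; the values being Halberstadt's tables). Proved
  on the way, for all residue characteristics: the reduction type, `p ∣ N_E`, `p² ∣ N_E` and
  Rohrlich's `localRootNumberAt` are invariants of the `ℚ_v`-isomorphism class of `E ×_ℚ ℚ_v`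
  (`hasGoodReductionAt_iff_of_smul_baseChange_eq`, `hasMultiplicativeReductionAt_iff_…`,
  `hasAdditiveReductionAt_iff_…`, `localRootNumberAt_eq_of_smul_baseChange_eq`,
  `natGenerator_dvd_conductorNorm_iff`, `natGenerator_sq_dvd_conductorNorm_iff`; Silverman AEC
  VII.1.3(b), VII.5.1, ATAEC IV.10.2), hence so is the Atkin–Lehner sign `[p ∣ N ? λ(Q_p)(f_E) : 1]`
  at every semistable place including those above `2, 3`
  (`atkinLehnerSign_eq_of_smul_baseChange_eq_of_not_hasAdditiveReductionAt`, via the tree's theorem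
  `atkinLehnerEigenvalueAt_eq_localRootNumberAt_of_not_sq_dvd`, `λ(p) = −a_p = w_p`); and a local
  isomorphism invariant of elliptic curves over `ℚ` is the restriction of a `ℚ_v`-invariant table on
  Weierstrass curves over `ℚ_v` (`exists_table_of_forall_smul_baseChange_eq`, choice). The trust base
  of `exists_local_tables_two_three` in the tree is thus {Modularity, Kellock–Dokchitser Rem. 2.2 above
  `p ≥ 5` (`WeierstrassCurve.atkinLehnerEigenvalueAt_eq_localRootNumberAt`), locality of `λ(Q_p)(f_E)`
  in `E ×_ℚ ℚ_p` at the additive `p ∈ {2, 3}`} — the last being the local Langlands input of Rem. 2.2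
  that no theorem of the tree provides.

## References

* [KellockDokchitser2023] L. Cowland Kellock, V. Dokchitser, *Root numbers and parity phenomena*,
  Bull. Lond. Math. Soc. 55 (2023), 2557–2597, Def. 2.1, Rem. 2.2, Thm. 2.3, Lemma 2.6 (PDF pp. 7–8
  of `paper:arxiv-2303.07883`).
* [Halberstadt1998CRAS] E. Halberstadt, *Signes locaux des courbes elliptiques en 2 et 3*, C. R.
  Acad. Sci. Paris 326 (1998), 1047–1052 (not held).
* [DeligneAntwerpII1973] P. Deligne, *Les constantes des équations fonctionnelles des fonctions L*,
  Antwerp II, LNM 349 (1973), 501–597 (not held).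
* [Knapp1993] A. W. Knapp, *Elliptic curves*, Math. Notes 40 (1993), Thm. 9.27.
* [BCDTJAMS2001] C. Breuil, B. Conrad, F. Diamond, R. Taylor, JAMS 14 (2001), Thm. A.
* [Rohrlich1993Compositio] D. Rohrlich, Compositio Math. 87 (1993), Prop. 2.
* [Rohrlich1994CRM] D. Rohrlich, *Elliptic curves and the Weil–Deligne group*, CRM Proc. 4 (1994), §19.
* [SilvermanAEC2009] J. H. Silverman, *The Arithmetic of Elliptic Curves*, GTM 106, 2nd ed. 2009,
  VII.1 Prop. 1.3, VII.5 Prop. 5.1.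
* [Silverman1994] J. H. Silverman, *Advanced Topics in the Arithmetic of Elliptic Curves*, GTM 151,
  IV.10.2.
-/

noncomputable section

open scoped Classical MatrixGroups

open CongruenceSubgroup Literature.NumberTheory.EllipticCurves.ModularForms IsDedekindDomain
  Rat.HeightOneSpectrum WeierstrassCurve

namespace Literature.NumberTheory.EllipticCurves

/-! ### Rohrlich's table above `p ≥ 5` is `±1`-valued -/

/-- The residue field of `O_v = v.adicCompletionIntegers ℚ` has the characteristic of `ℤ ⧸ v`
(both are `𝔽_p`, `p` the prime under `v`; `ℤ ⧸ v ≃+* κ(O_v)`,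
`IsDedekindDomain.HeightOneSpectrum.residueFieldEquiv`). Bridge between the guard
`3 < ringChar (ℤ ⧸ v)` of the statement file and the residue-characteristic guard of
`WeierstrassCurve.localRootNumber_sq_eq_one`. [folklore] -/
theorem Rat.ringChar_residueField_adicCompletionIntegers (v : HeightOneSpectrum ℤ) :
    ringChar (IsLocalRing.ResidueField (v.adicCompletionIntegers ℚ)) = ringChar (ℤ ⧸ v.asIdeal) := by
  haveI : CharP (IsLocalRing.ResidueField (v.adicCompletionIntegers ℚ)) (ringChar (ℤ ⧸ v.asIdeal)) :=
    charP_of_injective_ringHom (f := (HeightOneSpectrum.residueFieldEquiv ℚ v).toRingHom)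
      (HeightOneSpectrum.residueFieldEquiv ℚ v).injective _
  exact ringChar.eq _ _

/-- Above a prime `p ≥ 5` Rohrlich's local root number over `O_v ⊆ ℚ_v` is a sign
(Rohrlich 1993, Prop. 2; the tree's `localRootNumber_sq_eq_one_holds`, the residue field `𝔽_p` of
`O_v` being finite of characteristic `p > 3`). [cite: Rohrlich1993Compositio, Prop. 2] -/
theorem localRootNumber_adicCompletion_eq_one_or {v : HeightOneSpectrum ℤ}
    (hv : 3 < ringChar (ℤ ⧸ v.asIdeal)) (W' : WeierstrassCurve (v.adicCompletion ℚ)) :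
    W'.localRootNumber (v.adicCompletionIntegers ℚ) = 1 ∨
      W'.localRootNumber (v.adicCompletionIntegers ℚ) = -1 := by
  have h := W'.localRootNumber_sq_eq_one_holds (v.adicCompletionIntegers ℚ)
    (Or.inr (by rwa [Rat.ringChar_residueField_adicCompletionIntegers]))
  rwa [sq, mul_self_eq_one_iff] at h

/-! ### `∏ᶠ` over the finite places as a product over the primes dividing the conductor -/

/-- A `finprod` over the finite places of `ℚ` of an integer-valued function which is `1` away
from the places over `N.primeFactors` is the finite product over `p ∣ N`, the place under `p`
being `primesEquiv.symm p` (pattern of `WeierstrassCurve.finprod_localRootNumberAt_eq_prod`).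
[folklore] -/
theorem finprod_eq_prod_attach_primeFactors {N : ℕ} (g : HeightOneSpectrum ℤ → ℤ)
    (hg : ∀ v, g v ≠ 1 → natGenerator v ∈ N.primeFactors) :
    ∏ᶠ v, g v = ∏ p ∈ N.primeFactors.attach,
      g ((primesEquiv (R := ℤ)).symm ⟨p.1, Nat.prime_of_mem_primeFactors p.2⟩) := by
  classical
  set φ : {p // p ∈ N.primeFactors} → HeightOneSpectrum ℤ :=
    fun p ↦ (primesEquiv (R := ℤ)).symm ⟨p.1, Nat.prime_of_mem_primeFactors p.2⟩ with hφ
  have hφinj : Function.Injective φ := by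
    intro p q h
    have h' := congrArg (fun v : HeightOneSpectrum ℤ ↦ ((primesEquiv v : Nat.Primes) : ℕ)) h
    simp only [hφ, Equiv.apply_symm_apply] at h'
    exact Subtype.ext h'
  have hsupp : (Function.mulSupport g) ⊆ ((N.primeFactors.attach.image φ : Finset _) : Set _) := by
    intro v hv
    rw [Function.mem_mulSupport] at hv
    have hmem := hg v hv
    rw [Finset.coe_image]
    refine ⟨⟨natGenerator v, hmem⟩, by simp, ?_⟩
    rw [hφ, Equiv.symm_apply_eq]
    rfl
  rw [finprod_eq_prod_of_mulSupport_subset _ hsupp, Finset.prod_image fun p _ q _ h ↦ hφinj h]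

/-! ### The product formula for the analytic root number from modularity and Atkin–Lehner -/

/-- **`w(E) = −∏ᶠ_v g(v)` for any `g` interpolating the Atkin–Lehner eigenvalues of `f_E`.**
Assume the Modularity Theorem (`exists_isNewformOf`). Let `W/ℚ` be elliptic and
`g : {finite places} → ℤ` with `g(v) = λ(Q_p)(f)` for `p ∣ N_W` and `g(v) = 1` for `p ∤ N_W`
(`p` the prime under `v`, `f ∈ S₂(Γ₀(N_W))` the newform of `W`). Then `W.rootNumber = −∏ᶠ_v g(v)`:
`ε(f) = ∏_{p ∣ N_W} λ(Q_p)` (Knapp 1993, Thm. 9.27(c), `frickeEigenvalue_eq_prod_…_holds`)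
`= ∏ᶠ_v g(v)`, Hecke's functional equation gives `Λ(E, 2 − s) = −ε(f) Λ(E, s)`
(`hasFunctionalEquationSign_of_isNewformOf`), and the sign of the functional equation is unique and
is `W.rootNumber` (`hasFunctionalEquationSign_rootNumber_of_modularity`,
`hasFunctionalEquationSign_unique_holds`). (Kellock–Dokchitser 2023, Def. 2.1 and Rem. 2.2.)
[cite: KellockDokchitser2023, Def. 2.1 and Rem. 2.2] [cite: Knapp1993, Thm. 9.27(c)] -/
theorem rootNumber_eq_neg_finprod_of_exists_isNewformOf (hmod : exists_isNewformOf)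
    (W : WeierstrassCurve ℚ) [W.IsElliptic] [NeZero (W.conductorNorm ℤ)]
    (g : HeightOneSpectrum ℤ → ℤ)
    (hg : ∀ (f : CuspForm (Gamma0 (W.conductorNorm ℤ)) 2), IsNewformOf W f →
      ∀ v : HeightOneSpectrum ℤ, (g v : ℂ) =
        if natGenerator v ∣ W.conductorNorm ℤ then atkinLehnerEigenvalueAt f (natGenerator v)
        else 1) :
    W.rootNumber = -∏ᶠ v, g v := by
  have hmodU : existsUnique_isNewformOf := existsUnique_isNewformOf_of_exists hmod
  have hE : W.HasEntireLFunction := hasEntireLFunction_rat_of_modularity hmodU W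
  obtain ⟨f, hf⟩ := hmod W
  obtain ⟨Λ, hΛ, hfe⟩ :=
    IsNewform0.exists_functional_equation_holds (N := W.conductorNorm ℤ) (k := (2 : ℤ)) hf.1
  -- the support of `g` lies over the primes dividing the conductor
  have hsupp : ∀ v, g v ≠ 1 → natGenerator v ∈ (W.conductorNorm ℤ).primeFactors := by
    intro v hv
    by_contra hmem
    have hndvd : ¬ natGenerator v ∣ W.conductorNorm ℤ := fun hd ↦
      hmem (Nat.mem_primeFactors.mpr ⟨prime_natGenerator v, hd, NeZero.ne _⟩)
    have h := hg f hf v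
    rw [if_neg hndvd] at h
    exact hv (by exact_mod_cast h)
  -- `ε(f) = ∏_{p ∣ N} λ(Q_p) = ∏ᶠ_v g v`
  have hprod : ((∏ᶠ v, g v : ℤ) : ℂ) = frickeEigenvalue f := by
    rw [IsNewform0.frickeEigenvalue_eq_prod_atkinLehnerEigenvalueAt_holds hf.1,
      finprod_eq_prod_attach_primeFactors g hsupp, Int.cast_prod]
    conv_rhs => rw [← Finset.prod_attach]
    refine Finset.prod_congr rfl fun p _ ↦ ?_
    have hp : natGenerator ((primesEquiv (R := ℤ)).symm
        ⟨p.1, Nat.prime_of_mem_primeFactors p.2⟩) = p.1 :=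
      congrArg Subtype.val
        ((primesEquiv (R := ℤ)).apply_symm_apply ⟨p.1, Nat.prime_of_mem_primeFactors p.2⟩)
    rw [hg f hf, hp, if_pos (Nat.dvd_of_mem_primeFactors p.2)]
  -- both `W.rootNumber` and `-∏ᶠ g` are signs of the functional equation
  have h₁ : W.HasFunctionalEquationSign W.rootNumber :=
    W.hasFunctionalEquationSign_rootNumber_of_modularity hmodU
      (fun _ _ ↦ IsNewform0.exists_functional_equation_holds)
      (fun _ _ ↦ IsNewform0.frickeEigenvalue_eq_one_or_eq_neg_one_holds)
  have h₂ : W.HasFunctionalEquationSign (-∏ᶠ v, g v) :=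
    W.hasFunctionalEquationSign_of_isNewformOf hE hf hΛ hfe (by rw [Int.cast_neg, hprod])
  exact W.hasFunctionalEquationSign_unique_holds h₁ h₂

/-- **Rohrlich's table above `p ≥ 5` interpolates the Atkin–Lehner eigenvalues** (Kellock–Dokchitser
2023, Rem. 2.2 at `p ∣ N_E`, i.e. the named fact `atkinLehnerEigenvalueAt_eq_localRootNumberAt`;
Thm. 2.3(ii), `w = 1` at good reduction, at `p ∤ N_E`, via `f_v = 0 ↔` good reduction,
`natGenerator_mem_primeFactors_conductorNorm_of_localRootNumberAt_ne_one`). For elliptic `W/ℚ` with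
newform `f` and a place `v` of residue characteristic `> 3`: `w_v(E) = λ(Q_p)(f)` if `p ∣ N_W` and
`w_v(E) = 1` otherwise. [cite: KellockDokchitser2023, Rem. 2.2 and Thm. 2.3] -/
theorem localRootNumberAt_eq_ite_of_atkinLehner (W : WeierstrassCurve ℚ) [W.IsElliptic]
    [NeZero (W.conductorNorm ℤ)] (hF1 : W.atkinLehnerEigenvalueAt_eq_localRootNumberAt)
    {f : CuspForm (Gamma0 (W.conductorNorm ℤ)) 2} (hf : IsNewformOf W f)
    {v : HeightOneSpectrum ℤ} (hv : 3 < ringChar (ℤ ⧸ v.asIdeal)) :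
    ((W.localRootNumberAt v : ℤ) : ℂ) =
      if natGenerator v ∣ W.conductorNorm ℤ then atkinLehnerEigenvalueAt f (natGenerator v)
      else 1 := by
  by_cases hdvd : natGenerator v ∣ W.conductorNorm ℤ
  · rw [if_pos hdvd]
    have h := hF1 hf (primesEquiv v) hdvd (fun _ ↦ by rwa [Equiv.symm_apply_apply])
    rw [Equiv.symm_apply_apply] at h
    exact h.symm
  · rw [if_neg hdvd]
    have h1 : W.localRootNumberAt v = 1 := by
      by_contra hne
      exact hdvd (Nat.dvd_of_mem_primeFactors
        (W.natGenerator_mem_primeFactors_conductorNorm_of_localRootNumberAt_ne_one hne))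
    rw [h1, Int.cast_one]

/-! ### The reduction of `exists_local_tables_two_three` -/

/-- **`exists_local_tables_two_three` from the Modularity Theorem and Kellock–Dokchitser's
Remark 2.2** (Kellock–Dokchitser 2023, Def. 2.1, Rem. 2.2, Thm. 2.3 (PDF pp. 7–8); Halberstadt 1998;
Deligne 1973). Hypotheses: `hmod`, the Modularity Theorem `exists_isNewformOf` (BCDT 2001,
Thm. A); `hF1`, Rem. 2.2 at the primes `p ≥ 5` against Rohrlich's list (the named fact
`WeierstrassCurve.atkinLehnerEigenvalueAt_eq_localRootNumberAt`, for every `W`); `hloc`, Rem. 2.2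
with Def. 2.1, Thm. 2.3(ii) and Lemma 2.6's "the root number `w(E/F_v)` only depends on the
isomorphism class of `E/F_v`" at the places of residue characteristic `≤ 3`, in table form — for
each such `v` a `±1`-valued function `w_v` of Weierstrass curves over `ℚ_v`, invariant under changes
of variables over `ℚ_v`, with `w_v(E ×_ℚ ℚ_v) = λ(Q_p)(f_E)` for `p ∣ N_E` and `= 1` for `p ∤ N_E`
(Halberstadt's tables at `2` and `3` composed with Rem. 2.2; not in the tree in any form). The tables
produced are Rohrlich's `localRootNumber` over `O_v` on elliptic curves (and `1` on singular ones)
above `p ≥ 5` — `±1`-valued and isomorphism invariant by `localRootNumber_sq_eq_one_holds`,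
`localRootNumber_smul_holds` — and the hypothesised tables above `2, 3`; the product formula is
`rootNumber_eq_neg_finprod_of_exists_isNewformOf` with `localRootNumberAt_eq_ite_of_atkinLehner`.
[cite: KellockDokchitser2023, Def. 2.1, Rem. 2.2 and Thm. 2.3] [cite: Halberstadt1998CRAS, Théorème]
[cite: Knapp1993, Thm. 9.27] -/
theorem exists_local_tables_two_three_of_atkinLehner (hmod : exists_isNewformOf)
    (hF1 : ∀ W : WeierstrassCurve ℚ, W.atkinLehnerEigenvalueAt_eq_localRootNumberAt)
    (hloc : ∀ v : HeightOneSpectrum ℤ, ringChar (ℤ ⧸ v.asIdeal) ≤ 3 →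
      ∃ wv : WeierstrassCurve (v.adicCompletion ℚ) → ℤ,
        (∀ W', wv W' = 1 ∨ wv W' = -1) ∧
        (∀ W' (C : VariableChange (v.adicCompletion ℚ)), wv (C • W') = wv W') ∧
        ∀ (W : WeierstrassCurve ℚ) [W.IsElliptic] [NeZero (W.conductorNorm ℤ)]
          (f : CuspForm (Gamma0 (W.conductorNorm ℤ)) 2), IsNewformOf W f →
          (wv (W.baseChange (v.adicCompletion ℚ)) : ℂ) =
            if natGenerator v ∣ W.conductorNorm ℤ then atkinLehnerEigenvalueAt f (natGenerator v)
            else 1) :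
    exists_local_tables_two_three := by
  choose w₂₃ hw₁ hw₂ hw₃ using hloc
  refine ⟨fun v W' ↦ if hv : 3 < ringChar (ℤ ⧸ v.asIdeal) then
      (if W'.IsElliptic then W'.localRootNumber (v.adicCompletionIntegers ℚ) else 1)
    else w₂₃ v (not_lt.mp hv) W', ?_, ?_, ?_, ?_⟩
  · -- (1) the tables are `±1`-valued
    intro v W'
    dsimp only
    by_cases hv : 3 < ringChar (ℤ ⧸ v.asIdeal)
    · rw [dif_pos hv]
      by_cases hW' : W'.IsElliptic
      · rw [if_pos hW']
        exact localRootNumber_adicCompletion_eq_one_or hv W'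
      · rw [if_neg hW']
        exact Or.inl rfl
    · rw [dif_neg hv]
      exact hw₁ v (not_lt.mp hv) W'
  · -- (2) invariance under changes of variables over `ℚ_v`
    intro v W' C
    dsimp only
    by_cases hv : 3 < ringChar (ℤ ⧸ v.asIdeal)
    · rw [dif_pos hv, dif_pos hv]
      by_cases hW' : W'.IsElliptic
      · haveI := hW'
        rw [if_pos (inferInstance : (C • W').IsElliptic), if_pos hW']
        exact W'.localRootNumber_smul_holds (v.adicCompletionIntegers ℚ) C
      · have hC : ¬ (C • W').IsElliptic := fun h ↦ hW' (by
          haveI := h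
          simpa using (inferInstance : (C⁻¹ • (C • W')).IsElliptic))
        rw [if_neg hC, if_neg hW']
    · rw [dif_neg hv, dif_neg hv]
      exact hw₂ v (not_lt.mp hv) W' C
  · -- (3) agreement with Rohrlich's `localRootNumber` above `p ≥ 5`
    intro v W' hW' hv
    dsimp only
    rw [dif_pos hv, if_pos hW']
  · -- (4) the product formula for the analytic root number
    intro W hW
    haveI := hW
    haveI : NeZero (W.conductorNorm ℤ) := ⟨(W.conductorNorm_pos_holds).ne'⟩
    refine rootNumber_eq_neg_finprod_of_exists_isNewformOf hmod W _ fun f hf v ↦ ?_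
    dsimp only
    by_cases hv : 3 < ringChar (ℤ ⧸ v.asIdeal)
    · haveI : (W.baseChange (v.adicCompletion ℚ)).IsElliptic :=
        inferInstanceAs (W.map (algebraMap ℚ (v.adicCompletion ℚ))).IsElliptic
      rw [dif_pos hv, if_pos (inferInstance : (W.baseChange (v.adicCompletion ℚ)).IsElliptic)]
      exact localRootNumberAt_eq_ite_of_atkinLehner W (hF1 W) hf hv
    · rw [dif_neg hv]
      exact hw₃ v (not_lt.mp hv) W f hf

/-! ### Invariants of the local curve: reduction type, `p ∣ N_E`, `p² ∣ N_E`, Rohrlich's sign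

Two elliptic `W₁, W₂ / ℚ` whose base changes to `ℚ_v` are `ℚ_v`-isomorphic
(`C • (W₁ ×_ℚ ℚ_v) = W₂ ×_ℚ ℚ_v` for a change of variables `C` over `ℚ_v`) have `ℚ_v`-isomorphic
chosen local minimal models at `v`, i.e. two minimal Weierstrass equations of one elliptic curve over
`ℚ_v`; these differ by `⟨u, r, s, t⟩` with `u ∈ O_v^×`, `r, s, t ∈ O_v` (Silverman AEC VII.1,
Prop. 1.3(b)), so every datum read off a minimal model agrees: the reduction type (VII.5, Prop. 5.1),
hence `f_v = 0`, `f_v ≥ 2`, i.e. `p ∣ N_E`, `p² ∣ N_E` (Silverman ATAEC IV.10.2), and Rohrlich's case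
list `localRootNumberAt` (the tree's `localRootNumber_smul_holds`). This is the formal content of "the
root number `w(E/F_v)` only depends on the isomorphism class of `E/F_v`" (Kellock–Dokchitser 2023,
proof of Lemma 2.6) for the invariants the tree has. -/

section LocalCurve

variable {v : HeightOneSpectrum ℤ} {W₁ W₂ : WeierstrassCurve ℚ}
  {C : VariableChange (v.adicCompletion ℚ)}

/-- The chosen local minimal models at `v` of two curves over `ℚ` with `ℚ_v`-isomorphic base changes
are `ℚ_v`-isomorphic (each is a change of variables of its base change, Mathlib
`WeierstrassCurve.minimal`; Silverman AEC VII.1, Prop. 1.3(a)). [folklore] -/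
theorem exists_localMinimalModel_eq_smul_of_smul_baseChange_eq
    (hC : C • W₁.baseChange (v.adicCompletion ℚ) = W₂.baseChange (v.adicCompletion ℚ)) :
    ∃ D : VariableChange (v.adicCompletion ℚ),
      W₂.localMinimalModel v = D • W₁.localMinimalModel v := by
  obtain ⟨D₁, hD₁⟩ : ∃ D : VariableChange (v.adicCompletion ℚ),
      W₁.localMinimalModel v = D • W₁.baseChange (v.adicCompletion ℚ) := ⟨_, rfl⟩
  obtain ⟨D₂, hD₂⟩ : ∃ D : VariableChange (v.adicCompletion ℚ),
      W₂.localMinimalModel v = D • W₂.baseChange (v.adicCompletion ℚ) := ⟨_, rfl⟩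
  exact ⟨D₂ * C * D₁⁻¹, by rw [hD₂, ← hC, hD₁, mul_smul, mul_smul, inv_smul_smul]⟩

/-- Good reduction at `v` is a property of the `ℚ_v`-isomorphism class of the local curve
(Silverman AEC VII.5, Prop. 5.1(a) with VII.1, Prop. 1.3(b); the tree's
`hasGoodReduction_iff_of_isMinimal_of_eq_smul`). [cite: SilvermanAEC2009, VII.5 Prop. 5.1] -/
theorem hasGoodReductionAt_iff_of_smul_baseChange_eq
    (hC : C • W₁.baseChange (v.adicCompletion ℚ) = W₂.baseChange (v.adicCompletion ℚ)) :
    W₂.HasGoodReductionAt v ↔ W₁.HasGoodReductionAt v := by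
  obtain ⟨D, hD⟩ := exists_localMinimalModel_eq_smul_of_smul_baseChange_eq hC
  exact hasGoodReduction_iff_of_isMinimal_of_eq_smul (v.adicCompletionIntegers ℚ) hD

/-- Multiplicative reduction at `v` is a property of the `ℚ_v`-isomorphism class of the local curve of
an elliptic `W₁` (Silverman AEC VII.5, Prop. 5.1(b) with VII.1, Prop. 1.3(b); the tree's
`hasMultiplicativeReduction_iff_of_isMinimal_of_eq_smul`). [cite: SilvermanAEC2009, VII.5 Prop. 5.1] -/
theorem hasMultiplicativeReductionAt_iff_of_smul_baseChange_eq [W₁.IsElliptic]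
    (hC : C • W₁.baseChange (v.adicCompletion ℚ) = W₂.baseChange (v.adicCompletion ℚ)) :
    W₂.HasMultiplicativeReductionAt v ↔ W₁.HasMultiplicativeReductionAt v := by
  obtain ⟨D, hD⟩ := exists_localMinimalModel_eq_smul_of_smul_baseChange_eq hC
  haveI := W₁.isElliptic_localMinimalModel v
  exact hasMultiplicativeReduction_iff_of_isMinimal_of_eq_smul (v.adicCompletionIntegers ℚ) hD
    (W₁.localMinimalModel v).isUnit_Δ.ne_zero

/-- Additive reduction at `v` is a property of the `ℚ_v`-isomorphism class of the local curve of an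
elliptic `W₁` (Silverman AEC VII.5, Prop. 5.1(c) with VII.1, Prop. 1.3(b); the tree's
`hasAdditiveReduction_iff_of_isMinimal_of_eq_smul`). [cite: SilvermanAEC2009, VII.5 Prop. 5.1] -/
theorem hasAdditiveReductionAt_iff_of_smul_baseChange_eq [W₁.IsElliptic]
    (hC : C • W₁.baseChange (v.adicCompletion ℚ) = W₂.baseChange (v.adicCompletion ℚ)) :
    W₂.HasAdditiveReductionAt v ↔ W₁.HasAdditiveReductionAt v := by
  obtain ⟨D, hD⟩ := exists_localMinimalModel_eq_smul_of_smul_baseChange_eq hC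
  haveI := W₁.isElliptic_localMinimalModel v
  exact hasAdditiveReduction_iff_of_isMinimal_of_eq_smul (v.adicCompletionIntegers ℚ) hD
    (W₁.localMinimalModel v).isUnit_Δ.ne_zero

/-- Rohrlich's local root number at `v` is an invariant of the `ℚ_v`-isomorphism class of the local
curve of an elliptic `W₁` (Rohrlich 1994, §19; the tree's `localRootNumber_smul_holds` over
`O_v ⊆ ℚ_v`). [cite: Rohrlich1994CRM, §19] -/
theorem localRootNumberAt_eq_of_smul_baseChange_eq [W₁.IsElliptic]
    (hC : C • W₁.baseChange (v.adicCompletion ℚ) = W₂.baseChange (v.adicCompletion ℚ)) :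
    W₂.localRootNumberAt v = W₁.localRootNumberAt v := by
  haveI : (W₁.baseChange (v.adicCompletion ℚ)).IsElliptic :=
    inferInstanceAs (W₁.map (algebraMap ℚ (v.adicCompletion ℚ))).IsElliptic
  unfold localRootNumberAt
  rw [← hC]
  exact (W₁.baseChange (v.adicCompletion ℚ)).localRootNumber_smul_holds
    (v.adicCompletionIntegers ℚ) C

variable (v) in
/-- **`p ∣ N_E` iff bad reduction at the place over `p`** (`v_p(N_E) = f_v`,
`factorization_conductorNorm_holds`; `f_v = 0 ↔` good reduction, Silverman ATAEC IV.10.2(a),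
`conductorExponent_eq_zero_iff_holds`). [cite: Silverman1994, IV.10.2(a)] -/
theorem natGenerator_dvd_conductorNorm_iff (W : WeierstrassCurve ℚ) [W.IsElliptic] :
    natGenerator v ∣ W.conductorNorm ℤ ↔ ¬ W.HasGoodReductionAt v := by
  have h0 : W.conductorExponent v = 0 ↔ W.HasGoodReductionAt v :=
    conductorExponent_eq_zero_iff_holds v W
  rw [← h0, ← factorization_conductorNorm_holds W v,
    (prime_natGenerator v).dvd_iff_one_le_factorization (W.conductorNorm_pos_holds).ne']
  omega

variable (v) in
/-- **`p² ∣ N_E` iff additive reduction at the place over `p`** (`v_p(N_E) = f_v`,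
`factorization_conductorNorm_holds`; `f_v ≥ 2 ↔` additive reduction, Silverman ATAEC IV.10.2(c),
`two_le_conductorExponent_iff_holds`). [cite: Silverman1994, IV.10.2(c)] -/
theorem natGenerator_sq_dvd_conductorNorm_iff (W : WeierstrassCurve ℚ) [W.IsElliptic] :
    natGenerator v ^ 2 ∣ W.conductorNorm ℤ ↔ W.HasAdditiveReductionAt v := by
  have h2 : 2 ≤ W.conductorExponent v ↔ W.HasAdditiveReductionAt v :=
    two_le_conductorExponent_iff_holds v W
  rw [← h2, ← factorization_conductorNorm_holds W v]
  exact (prime_natGenerator v).pow_dvd_iff_le_factorization (W.conductorNorm_pos_holds).ne'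

/-- **The Atkin–Lehner sign at a semistable place is an invariant of the local curve** (all residue
characteristics, including `2, 3`). For elliptic `W₁, W₂ / ℚ` with newforms `f₁, f₂`, `ℚ_v`-isomorphic
over `ℚ_v`, and `W₁` not additive at `v`: the interpolants `[p ∣ N ? λ(Q_p)(f) : 1]` agree. Indeed
`p ∣ N_i ↔` bad reduction and `p² ∣ N_i ↔` additive reduction are local isomorphism invariants
(`natGenerator_dvd_conductorNorm_iff`, `natGenerator_sq_dvd_conductorNorm_iff`, Silverman ATAEC
IV.10.2), and at `p ∥ N_i` Kellock–Dokchitser's Remark 2.2 is the theorem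
`atkinLehnerEigenvalueAt_eq_localRootNumberAt_of_not_sq_dvd` (`λ(p) = −a_p(f) = −a_p(E) = w_p(E)`,
Knapp 1993, Thm. 9.27; multiplicative reduction, no hypothesis at `2, 3`), with `w_p(E)` a local
isomorphism invariant (`localRootNumberAt_eq_of_smul_baseChange_eq`).
[cite: KellockDokchitser2023, Rem. 2.2 and Thm. 2.3 (iii), (iv)] [cite: Knapp1993, Thm. 9.27] -/
theorem atkinLehnerSign_eq_of_smul_baseChange_eq_of_not_hasAdditiveReductionAt
    [W₁.IsElliptic] [W₂.IsElliptic] [NeZero (W₁.conductorNorm ℤ)] [NeZero (W₂.conductorNorm ℤ)]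
    {f₁ : CuspForm (Gamma0 (W₁.conductorNorm ℤ)) 2} {f₂ : CuspForm (Gamma0 (W₂.conductorNorm ℤ)) 2}
    (hf₁ : IsNewformOf W₁ f₁) (hf₂ : IsNewformOf W₂ f₂)
    (hC : C • W₁.baseChange (v.adicCompletion ℚ) = W₂.baseChange (v.adicCompletion ℚ))
    (hadd : ¬ W₁.HasAdditiveReductionAt v) :
    (if natGenerator v ∣ W₁.conductorNorm ℤ then atkinLehnerEigenvalueAt f₁ (natGenerator v)
      else 1 : ℂ) =
      if natGenerator v ∣ W₂.conductorNorm ℤ then atkinLehnerEigenvalueAt f₂ (natGenerator v)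
      else 1 := by
  have hdvd : natGenerator v ∣ W₁.conductorNorm ℤ ↔ natGenerator v ∣ W₂.conductorNorm ℤ := by
    rw [natGenerator_dvd_conductorNorm_iff v W₁, natGenerator_dvd_conductorNorm_iff v W₂,
      hasGoodReductionAt_iff_of_smul_baseChange_eq hC]
  by_cases h₁ : natGenerator v ∣ W₁.conductorNorm ℤ
  · have h₂ : natGenerator v ∣ W₂.conductorNorm ℤ := hdvd.mp h₁
    rw [if_pos h₁, if_pos h₂]
    have hsq₁ : ¬ natGenerator v ^ 2 ∣ W₁.conductorNorm ℤ := by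
      rwa [natGenerator_sq_dvd_conductorNorm_iff v W₁]
    have hsq₂ : ¬ natGenerator v ^ 2 ∣ W₂.conductorNorm ℤ := by
      rwa [natGenerator_sq_dvd_conductorNorm_iff v W₂,
        hasAdditiveReductionAt_iff_of_smul_baseChange_eq hC]
    have e₁ : atkinLehnerEigenvalueAt f₁ (natGenerator v) = (W₁.localRootNumberAt v : ℂ) := by
      have h := W₁.atkinLehnerEigenvalueAt_eq_localRootNumberAt_of_not_sq_dvd hf₁ (primesEquiv v)
        h₁ hsq₁
      rw [Equiv.symm_apply_apply] at h
      exact h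
    have e₂ : atkinLehnerEigenvalueAt f₂ (natGenerator v) = (W₂.localRootNumberAt v : ℂ) := by
      have h := W₂.atkinLehnerEigenvalueAt_eq_localRootNumberAt_of_not_sq_dvd hf₂ (primesEquiv v)
        h₂ hsq₂
      rw [Equiv.symm_apply_apply] at h
      exact h
    rw [e₁, e₂, localRootNumberAt_eq_of_smul_baseChange_eq hC]
  · have h₂ : ¬ natGenerator v ∣ W₂.conductorNorm ℤ := fun h ↦ h₁ (hdvd.mpr h)
    rw [if_neg h₁, if_neg h₂]

end LocalCurve

/-! ### Tables on Weierstrass curves over `ℚ_v` from local invariants of curves over `ℚ` -/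

/-- **A local isomorphism invariant of elliptic curves over `ℚ` is the restriction of a table.** If
`a : {Weierstrass curves over ℚ} → ℤ` is `±1`-valued on elliptic curves and `a W₁ = a W₂` whenever
`W₁ ×_ℚ ℚ_v` and `W₂ ×_ℚ ℚ_v` are `ℚ_v`-isomorphic, then there is a `±1`-valued table
`w_v : {Weierstrass curves over ℚ_v} → ℤ`, invariant under every change of variables over `ℚ_v`, with
`w_v(W ×_ℚ ℚ_v) = a W` for every elliptic `W / ℚ`: set `w_v(X) = a W` for any elliptic `W / ℚ` with
`W ×_ℚ ℚ_v ≅ X`, and `w_v(X) = 1` if there is none (pure logic and choice; this is how "`w(E/F_v)`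
only depends on the isomorphism class of `E/F_v`", Kellock–Dokchitser 2023, proof of Lemma 2.6, turns
an invariant into a table). [folklore] -/
theorem exists_table_of_forall_smul_baseChange_eq (v : HeightOneSpectrum ℤ)
    (a : WeierstrassCurve ℚ → ℤ) (ha : ∀ W : WeierstrassCurve ℚ, W.IsElliptic → a W = 1 ∨ a W = -1)
    (hloc : ∀ W₁ W₂ : WeierstrassCurve ℚ, W₁.IsElliptic → W₂.IsElliptic →
      ∀ C : VariableChange (v.adicCompletion ℚ),
        C • W₁.baseChange (v.adicCompletion ℚ) = W₂.baseChange (v.adicCompletion ℚ) → a W₁ = a W₂) :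
    ∃ wv : WeierstrassCurve (v.adicCompletion ℚ) → ℤ,
      (∀ W', wv W' = 1 ∨ wv W' = -1) ∧
      (∀ W' (C : VariableChange (v.adicCompletion ℚ)), wv (C • W') = wv W') ∧
      ∀ W : WeierstrassCurve ℚ, W.IsElliptic → wv (W.baseChange (v.adicCompletion ℚ)) = a W := by
  classical
  -- `P X`: the local curve `X` is `ℚ_v`-isomorphic to the base change of an elliptic curve over `ℚ`
  obtain ⟨P, hP⟩ : ∃ P : WeierstrassCurve (v.adicCompletion ℚ) → Prop, ∀ X, P X ↔
      ∃ W : WeierstrassCurve ℚ, W.IsElliptic ∧ ∃ C : VariableChange (v.adicCompletion ℚ),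
        C • W.baseChange (v.adicCompletion ℚ) = X :=
    ⟨_, fun _ ↦ Iff.rfl⟩
  have hPsmul : ∀ X (C : VariableChange (v.adicCompletion ℚ)), P (C • X) ↔ P X := by
    intro X C
    rw [hP, hP]
    constructor
    · rintro ⟨W, hW, C', hC'⟩
      exact ⟨W, hW, C⁻¹ * C', by rw [mul_smul, hC', inv_smul_smul]⟩
    · rintro ⟨W, hW, C', hC'⟩
      exact ⟨W, hW, C * C', by rw [mul_smul, hC']⟩
  refine ⟨fun X ↦ if h : P X then a ((hP X).mp h).choose else 1, ?_, ?_, ?_⟩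
  · intro X
    dsimp only
    by_cases h : P X
    · rw [dif_pos h]
      exact ha _ ((hP X).mp h).choose_spec.1
    · rw [dif_neg h]
      exact Or.inl rfl
  · intro X C
    dsimp only
    by_cases h : P X
    · have h' : P (C • X) := (hPsmul X C).mpr h
      rw [dif_pos h', dif_pos h]
      obtain ⟨hW', C', hC'⟩ := ((hP (C • X)).mp h').choose_spec
      obtain ⟨hW, C'', hC''⟩ := ((hP X).mp h).choose_spec
      refine hloc _ _ hW' hW (C''⁻¹ * C⁻¹ * C') ?_
      rw [mul_smul, mul_smul, hC', inv_smul_smul, inv_smul_eq_iff]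
      exact hC''.symm
    · have h' : ¬ P (C • X) := fun h' ↦ h ((hPsmul X C).mp h')
      rw [dif_neg h', dif_neg h]
  · intro W hW
    dsimp only
    have h : P (W.baseChange (v.adicCompletion ℚ)) := (hP _).mpr ⟨W, hW, 1, one_smul _ _⟩
    rw [dif_pos h]
    obtain ⟨hW', C', hC'⟩ := ((hP _).mp h).choose_spec
    exact hloc _ _ hW' hW C' hC'

/-! ### The reduction of `exists_local_tables_two_three` to its residual input at `2` and `3` -/

/-- **`exists_local_tables_two_three` from the Modularity Theorem, Kellock–Dokchitser's Remark 2.2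
above `p ≥ 5`, and the locality of the Atkin–Lehner sign at the *additive* places above `2, 3`.**
Compared with `exists_local_tables_two_three_of_atkinLehner`, the table hypothesis `hloc` at the
places of residue characteristic `≤ 3` is replaced by exactly what the tree cannot prove there:

* `hres` — for `v ∣ 6` and elliptic `W₁, W₂ / ℚ` with newforms `f₁, f₂` such that `W₁` has
  *additive* reduction at `v` and `W₁ ×_ℚ ℚ_v ≅ W₂ ×_ℚ ℚ_v` over `ℚ_v`:
  `λ(Q_p)(f₁) = λ(Q_p)(f₂)`. This is Kellock–Dokchitser 2023, Remark 2.2 ("the local root number at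
  a prime `p` agrees with the eigenvalue of the associated Atkin–Lehner involution", by the local
  Langlands correspondence for `GL₂` and modularity) combined with "the root number `w(E/F_v)` only
  depends on the isomorphism class of `E/F_v`" (proof of Lemma 2.6), at the additive places above
  `2, 3`, where the values are Halberstadt's tables (CRAS 326 (1998); not transcribed in the tree,
  whose `localRootNumber` is the junk value `0` there).

Everything else at `2, 3` is proved here: at good places the sign is `1` and at multiplicative places
it is `λ(p) = −a_p = w_p(E)` (`atkinLehnerSign_eq_of_smul_baseChange_eq_of_not_hasAdditiveReductionAt`,
Knapp 1993, Thm. 9.27; Kellock–Dokchitser Thm. 2.3 (ii)–(iv)), both local isomorphism invariants;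
`λ(Q_p) = ±1` (Knapp 1993, Thm. 9.27(b), `IsNewform0.atkinLehnerEigenvalueAt_eq_one_or_eq_neg_one`);
the newform of `W` is unique (`existsUnique_isNewformOf_of_exists`); and a local isomorphism
invariant is the restriction of a `ℚ_v`-invariant table (`exists_table_of_forall_smul_baseChange_eq`).
So the trust base of `exists_local_tables_two_three` in the tree is {Modularity
(`exists_isNewformOf`), Kellock–Dokchitser Rem. 2.2 above `p ≥ 5`
(`WeierstrassCurve.atkinLehnerEigenvalueAt_eq_localRootNumberAt`), locality of `λ(Q_p)(f_E)` in
`E ×_ℚ ℚ_p` at the additive `p ∈ {2, 3}`}.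
[cite: KellockDokchitser2023, Def. 2.1, Rem. 2.2, Thm. 2.3 and proof of Lemma 2.6 (PDF pp. 7–8)]
[cite: Halberstadt1998CRAS, Théorème] [cite: Knapp1993, Thm. 9.27] -/
theorem exists_local_tables_two_three_of_residual (hmod : exists_isNewformOf)
    (hF1 : ∀ W : WeierstrassCurve ℚ, W.atkinLehnerEigenvalueAt_eq_localRootNumberAt)
    (hres : ∀ v : HeightOneSpectrum ℤ, ringChar (ℤ ⧸ v.asIdeal) ≤ 3 →
      ∀ (W₁ W₂ : WeierstrassCurve ℚ) [W₁.IsElliptic] [W₂.IsElliptic]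
        [NeZero (W₁.conductorNorm ℤ)] [NeZero (W₂.conductorNorm ℤ)]
        (f₁ : CuspForm (Gamma0 (W₁.conductorNorm ℤ)) 2) (f₂ : CuspForm (Gamma0 (W₂.conductorNorm ℤ)) 2),
        IsNewformOf W₁ f₁ → IsNewformOf W₂ f₂ → W₁.HasAdditiveReductionAt v →
        ∀ C : VariableChange (v.adicCompletion ℚ),
          C • W₁.baseChange (v.adicCompletion ℚ) = W₂.baseChange (v.adicCompletion ℚ) →
          atkinLehnerEigenvalueAt f₁ (natGenerator v) = atkinLehnerEigenvalueAt f₂ (natGenerator v)) :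
    exists_local_tables_two_three := by
  have hmodU : existsUnique_isNewformOf := existsUnique_isNewformOf_of_exists hmod
  refine exists_local_tables_two_three_of_atkinLehner hmod hF1 fun v hv ↦ ?_
  -- the Atkin–Lehner sign `[p ∣ N_W ? λ(Q_p)(f) : 1]` is `±1`
  have hsign : ∀ (W : WeierstrassCurve ℚ) [W.IsElliptic] [NeZero (W.conductorNorm ℤ)]
      (f : CuspForm (Gamma0 (W.conductorNorm ℤ)) 2), IsNewformOf W f →
      (if natGenerator v ∣ W.conductorNorm ℤ then atkinLehnerEigenvalueAt f (natGenerator v)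
        else 1 : ℂ) = 1 ∨
      (if natGenerator v ∣ W.conductorNorm ℤ then atkinLehnerEigenvalueAt f (natGenerator v)
        else 1 : ℂ) = -1 := by
    intro W _ _ f hf
    by_cases hd : natGenerator v ∣ W.conductorNorm ℤ
    · rw [if_pos hd]
      exact hf.1.atkinLehnerEigenvalueAt_eq_one_or_eq_neg_one (prime_natGenerator v) hd
    · rw [if_neg hd]
      exact Or.inl rfl
  -- the sign is an invariant of the local curve: proved at semistable `v`, `hres` at additive `v`
  have hlocal : ∀ (W₁ W₂ : WeierstrassCurve ℚ) [W₁.IsElliptic] [W₂.IsElliptic]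
      [NeZero (W₁.conductorNorm ℤ)] [NeZero (W₂.conductorNorm ℤ)]
      (f₁ : CuspForm (Gamma0 (W₁.conductorNorm ℤ)) 2) (f₂ : CuspForm (Gamma0 (W₂.conductorNorm ℤ)) 2),
      IsNewformOf W₁ f₁ → IsNewformOf W₂ f₂ → ∀ C : VariableChange (v.adicCompletion ℚ),
      C • W₁.baseChange (v.adicCompletion ℚ) = W₂.baseChange (v.adicCompletion ℚ) →
      (if natGenerator v ∣ W₁.conductorNorm ℤ then atkinLehnerEigenvalueAt f₁ (natGenerator v)
        else 1 : ℂ) =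
      if natGenerator v ∣ W₂.conductorNorm ℤ then atkinLehnerEigenvalueAt f₂ (natGenerator v)
        else 1 := by
    intro W₁ W₂ _ _ _ _ f₁ f₂ hf₁ hf₂ C hC
    by_cases hadd : W₁.HasAdditiveReductionAt v
    · have h₁ : natGenerator v ∣ W₁.conductorNorm ℤ :=
        (dvd_pow_self _ two_ne_zero).trans ((natGenerator_sq_dvd_conductorNorm_iff v W₁).mpr hadd)
      have h₂ : natGenerator v ∣ W₂.conductorNorm ℤ :=
        (dvd_pow_self _ two_ne_zero).trans ((natGenerator_sq_dvd_conductorNorm_iff v W₂).mpr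
          ((hasAdditiveReductionAt_iff_of_smul_baseChange_eq hC).mpr hadd))
      rw [if_pos h₁, if_pos h₂]
      exact hres v hv W₁ W₂ f₁ f₂ hf₁ hf₂ hadd C hC
    · exact atkinLehnerSign_eq_of_smul_baseChange_eq_of_not_hasAdditiveReductionAt hf₁ hf₂ hC hadd
  -- an integer-valued version `a` of the sign (value `1` on singular curves)
  have key : ∀ W : WeierstrassCurve ℚ, ∃ z : ℤ, (z = 1 ∨ z = -1) ∧
      ∀ (_ : W.IsElliptic) (_ : NeZero (W.conductorNorm ℤ))
        (f : CuspForm (Gamma0 (W.conductorNorm ℤ)) 2), IsNewformOf W f →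
        (z : ℂ) = if natGenerator v ∣ W.conductorNorm ℤ then atkinLehnerEigenvalueAt f (natGenerator v)
          else 1 := by
    intro W
    by_cases hW : W.IsElliptic
    · haveI : NeZero (W.conductorNorm ℤ) := ⟨(W.conductorNorm_pos_holds).ne'⟩
      obtain ⟨f₀, hf₀⟩ := hmod W
      rcases hsign W f₀ hf₀ with h1 | h1
      · refine ⟨1, Or.inl rfl, fun _ _ f hf ↦ ?_⟩
        rw [(hmodU W).unique hf hf₀, h1, Int.cast_one]
      · refine ⟨-1, Or.inr rfl, fun _ _ f hf ↦ ?_⟩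
        rw [(hmodU W).unique hf hf₀, h1, Int.cast_neg, Int.cast_one]
    · exact ⟨1, Or.inl rfl, fun h ↦ absurd h hW⟩
  choose a ha₁ ha₂ using key
  -- `a` is a local isomorphism invariant of elliptic curves over `ℚ`
  have haloc : ∀ W₁ W₂ : WeierstrassCurve ℚ, W₁.IsElliptic → W₂.IsElliptic →
      ∀ C : VariableChange (v.adicCompletion ℚ),
        C • W₁.baseChange (v.adicCompletion ℚ) = W₂.baseChange (v.adicCompletion ℚ) →
        a W₁ = a W₂ := by
    intro W₁ W₂ hW₁ hW₂ C hC
    haveI := hW₁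
    haveI := hW₂
    haveI : NeZero (W₁.conductorNorm ℤ) := ⟨(W₁.conductorNorm_pos_holds).ne'⟩
    haveI : NeZero (W₂.conductorNorm ℤ) := ⟨(W₂.conductorNorm_pos_holds).ne'⟩
    obtain ⟨f₁, hf₁⟩ := hmod W₁
    obtain ⟨f₂, hf₂⟩ := hmod W₂
    have h := hlocal W₁ W₂ f₁ f₂ hf₁ hf₂ C hC
    rw [← ha₂ W₁ hW₁ inferInstance f₁ hf₁, ← ha₂ W₂ hW₂ inferInstance f₂ hf₂] at h
    exact_mod_cast h
  -- the table at `v`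
  obtain ⟨wv, hw₁, hw₂, hw₃⟩ :=
    exists_table_of_forall_smul_baseChange_eq v a (fun W _ ↦ ha₁ W) haloc
  refine ⟨wv, hw₁, hw₂, fun W _ _ f hf ↦ ?_⟩
  rw [hw₃ W inferInstance]
  exact ha₂ W inferInstance inferInstance f hf

end Literature.NumberTheory.EllipticCurves

end
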